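/- LEAD seat `ym-line-cbag-p1` (prover-ym-line-cbag-p1-g29-0), LINE 7 `GlueballBandRecursion`, item ⟨stmt-QuantumFields-22957⟩:
SAME-VOLUME SQUARING — the route's closes-target, the IR cell's strong-coupling rung `ColdDoublingRecursionStrongCoupling`, follows from the
single volume-comparison statement `TraceExcessVolumeComparison` of `…VolumeComparisonDefs.lean`; likewise the small-coupling (`∃ β₁`) rung
from the small-coupling volume comparison.  Sorry-free; `--supports stmt-QuantumFields-22957 --as helper`. -/
import Summits.QuantumFields.YangMills.Theorems.GlueballBandRecursionVolumeComparisonDefs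
import Summits.QuantumFields.YangMills.Theorems.BalabanLadderIRColdPurityBridgeSpectral
import Summits.QuantumFields.YangMills.Theorems.GlueballBandRecursionRateToolkit
import HarnessLib

/-!
# Route `GlueballBandRecursion`: the cold dyadic contraction from volume comparison alone (same-volume squaring)

Write `x_t(N) = traceExcess r.ρ β N t = Σ_{i ≠ i₀} rᵢ^t`, `rᵢ = λᵢ/λ₊ ∈ [0, 1]` the excited eigenvalue ratios of Lüscher's transfer matrix of
the spatial torus `(ℤ/N)³` (`DoublingDefect.exists_ratios_hasSum_traceExcess`), and `δᶜ_β(L) = coldDefect r.ρ β L =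
1 − Z_β(L³ × 2⌊L/4⌋)/Z_β(L³ × ⌊L/4⌋)²`.  Proved here:

* §1 **spectral positivity at fixed volume**: `x_{k+2}(N) ≤ x_{m+2}(N)` for `m ≤ k` (`traceExcess_antitone_time`) and
  `x_{2(m+2)}(N) ≤ x_{m+2}(N)²` (`traceExcess_two_mul_le_sq`: `Σ rᵢ^{2t} ≤ (Σ rᵢ^t)²` for non-negative terms);
* §2 **the defect/excess dictionary at the cold time** `⌊L/4⌋ = m + 2`: `δᶜ_β(L) ≤ 2·x_{m+2}(L)` and, when `x_{m+2}(L) ≤ 1`,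
  `x_{m+2}(L) ≤ 2·δᶜ_β(L)` (the tree's two-sided `2x/(1+x)² ≤ δᶜ ≤ 2x`, `ColdPurityBridge.one_sub_ratio_le/ge…`);
* §3 **the reductions**: `TraceExcessVolumeComparison → ColdDoublingRecursionStrongCoupling`
  (`coldDoublingRecursionStrongCoupling_of_volumeComparison`) and `TraceExcessVolumeComparisonSmallCoupling → ColdDoublingRecursionSmallCoupling`
  (`coldDoublingRecursionSmallCoupling_of_volumeComparison`), with `C = 8K² + 1`: for `L' ∈ [2L, 4L]` one has `⌊L'/4⌋ ≥ 2⌊L/4⌋`, so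
  `δᶜ(L') ≤ 2x_{⌊L'/4⌋}(L') ≤ 2x_{2⌊L/4⌋}(L') ≤ 2x_{⌊L/4⌋}(L')² ≤ 2K²x_{⌊L/4⌋}(L)² ≤ 8K²δᶜ(L)²`, the last step on the tree's uniform
  smallness `x_{⌊L/4⌋}(L) ≤ 1` for `L ≥ L₁` on the window (`Rate.traceExcess_small_of_large`); plus the two window weakenings
  `…SmallCoupling_of_…` (sanity).

So the rung's only non-free content is the comparison of the cold trace excess ACROSS SPATIAL VOLUMES at fixed Euclidean period — no one-particle
band, symbol, isolation or anchor is needed for the rung itself (they are needed for the finer cruxes K1/K2/K3′ of the route).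

HONEST FRAMING.  Implications only; `TraceExcessVolumeComparison` (and its small-coupling form) are OPEN route-posited statements; the conclusion is a
RECORD-type strong-coupling rung of the IR cell.  Nothing here bears on weak coupling, the continuum, or the Yang–Mills mass gap (Clay), which is NOT
proved by anything in this file.
-/

set_option autoImplicit false

noncomputable section

open Filter Topology
open Literature.MathematicalPhysics.QuantumFieldTheory
open Literature.MathematicalPhysics.QuantumFieldTheory.Balaban1983to89.Missing (strongCouplingRadius strongCouplingRadius_pos)
open Summit.QuantumFields.YangMills.Cruxes.IR.ColdPurityBridge (coldDefect ColdDoublingRecursionStrongCoupling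
  one_sub_ratio_le_two_mul_traceExcess one_sub_ratio_ge_of_traceExcess)
open Summit.QuantumFields.YangMills.Theorems.DoublingDefect (exists_ratios_hasSum_traceExcess)

namespace Summit.QuantumFields.YangMills.Theorems.GlueballBandRecursion

/-! ## §1 Spectral positivity at fixed spatial volume -/

section Spectral

variable {G : Type} [Group G] [TopologicalSpace G] [IsTopologicalGroup G] [CompactSpace G]
  [MeasurableSpace G] [BorelSpace G]

/-- For a non-negative summable family, `Σᵢ vᵢ² ≤ (Σᵢ vᵢ)²` (each `vᵢ ≤ Σ v`). [folklore] -/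
theorem hasSum_sq_le_sq {ι : Type*} {v : ι → ℝ} {S : ℝ} (hv : ∀ i, 0 ≤ v i) (hS : HasSum v S) :
    ∀ {T : ℝ}, HasSum (fun i => v i ^ 2) T → T ≤ S ^ 2 := by
  intro T hT
  have hle : ∀ i, v i ≤ S := fun i => le_hasSum hS i fun j _ => hv j
  have hcmp : ∀ i, v i ^ 2 ≤ S * v i := fun i => by
    rw [sq]; exact mul_le_mul_of_nonneg_right (hle i) (hv i)
  have h := hasSum_le hcmp hT (hS.mul_left S)
  simpa [sq] using h

/-- **The thermal trace excess is antitone in the Euclidean period at fixed spatial volume**: `x_{k+2}(N) ≤ x_{m+2}(N)` for `m ≤ k`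
(`β ≥ 0`; the excited ratios `λᵢ/λ₊` lie in `[0, 1]`). [folklore] -/
theorem traceExcess_antitone_time (r : LatticeRep G) {β : ℝ} (hβ : 0 ≤ β) (N : ℕ) [NeZero N] {m k : ℕ} (hmk : m ≤ k) :
    traceExcess r.ρ β N (k + 2) ≤ traceExcess r.ρ β N (m + 2) := by
  haveI : SecondCountableTopology G :=
    (r.continuous.isClosedEmbedding r.injective).isEmbedding.secondCountableTopology
  obtain ⟨ι, _, q, i₀, hq, -, -, -, hx⟩ := exists_ratios_hasSum_traceExcess r.continuous r.mem_unitary hβ N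
  refine hasSum_le (fun i => ?_) (hx k) (hx m)
  rcases eq_or_ne i i₀ with rfl | hne
  · simp
  · rw [Function.update_of_ne hne, Function.update_of_ne hne]
    exact pow_le_pow_of_le_one (hq i).1 (hq i).2 (by omega)

/-- **Same-volume squaring**: `x_{2(m+2)}(N) ≤ x_{m+2}(N)²` (`β ≥ 0`; the period `2(m+2)` is spelled `2m+2+2`) —
`Σ_{i≠i₀} rᵢ^{2t} ≤ (Σ_{i≠i₀} rᵢ^t)²` for non-negative ratios.  (The time-direction reflection-positivity fact `Z(2t) ≤ Z(t)²` read on the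
excited part of the spectrum.) [folklore] -/
theorem traceExcess_two_mul_le_sq (r : LatticeRep G) {β : ℝ} (hβ : 0 ≤ β) (N : ℕ) [NeZero N] (m : ℕ) :
    traceExcess r.ρ β N (2 * m + 2 + 2) ≤ traceExcess r.ρ β N (m + 2) ^ 2 := by
  haveI : SecondCountableTopology G :=
    (r.continuous.isClosedEmbedding r.injective).isEmbedding.secondCountableTopology
  obtain ⟨ι, _, q, i₀, hq, -, -, -, hx⟩ := exists_ratios_hasSum_traceExcess r.continuous r.mem_unitary hβ N
  set v : ι → ℝ := Function.update (fun i => q i ^ (m + 2)) i₀ 0 with hv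
  have hv0 : ∀ i, 0 ≤ v i := fun i => by
    rcases eq_or_ne i i₀ with rfl | hne
    · simp [hv]
    · rw [hv, Function.update_of_ne hne]; exact pow_nonneg (hq i).1 _
  have h2 : HasSum (fun i => v i ^ 2) (traceExcess r.ρ β N (2 * m + 2 + 2)) := by
    refine (hx (2 * m + 2)).congr_fun fun i => ?_
    rcases eq_or_ne i i₀ with rfl | hne
    · simp [hv]
    · rw [hv, Function.update_of_ne hne, Function.update_of_ne hne, ← pow_mul]
      congr 1; ring
  exact hasSum_sq_le_sq hv0 (hx m) h2

end Spectral

/-! ## §2 The defect/excess dictionary at the cold time `⌊L/4⌋` -/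

section Dictionary

variable {G : Type} [Group G] [TopologicalSpace G] [IsTopologicalGroup G] [CompactSpace G]
  [MeasurableSpace G] [BorelSpace G]

/-- `δᶜ_β(L) ≤ 2·x_{⌊L/4⌋}(L)` (`⌊L/4⌋ = m + 2`, `β ≥ 0`) — the upper half of the tree's dictionary, in the `coldDefect` spelling. -/
theorem coldDefect_le_two_mul_traceExcess (r : LatticeRep G) {β : ℝ} (hβ : 0 ≤ β) (L : ℕ) [NeZero L] (m : ℕ)
    (hL : L / 4 = m + 2) : coldDefect r.ρ β L ≤ 2 * traceExcess r.ρ β L (m + 2) := by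
  have h := one_sub_ratio_le_two_mul_traceExcess r hβ L m
  unfold coldDefect
  rw [hL]
  exact h

/-- `x_{⌊L/4⌋}(L) ≤ 2·δᶜ_β(L)` once `x_{⌊L/4⌋}(L) ≤ 1` (`⌊L/4⌋ = m + 2`, `β ≥ 0`) — from the lower half `2x/(1+x)² ≤ δᶜ` and `(1+x)² ≤ 4`. -/
theorem traceExcess_le_two_mul_coldDefect (r : LatticeRep G) {β : ℝ} (hβ : 0 ≤ β) (L : ℕ) [NeZero L] (m : ℕ)
    (hL : L / 4 = m + 2) (hx : traceExcess r.ρ β L (m + 2) ≤ 1) :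
    traceExcess r.ρ β L (m + 2) ≤ 2 * coldDefect r.ρ β L := by
  haveI : SecondCountableTopology G :=
    (r.continuous.isClosedEmbedding r.injective).isEmbedding.secondCountableTopology
  have h := one_sub_ratio_ge_of_traceExcess r hβ L m
  have hx0 : 0 ≤ traceExcess r.ρ β L (m + 2) := Rate.traceExcess_nonneg r.continuous r.mem_unitary hβ L m
  set x : ℝ := traceExcess r.ρ β L (m + 2) with hxdef
  have hδ : 2 * x / (1 + x) ^ 2 ≤ coldDefect r.ρ β L := by
    unfold coldDefect; rw [hL]; exact h
  have hsq : (1 + x) ^ 2 ≤ 4 := by nlinarith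
  have hpos : 0 < (1 + x) ^ 2 := by positivity
  have h1 : 2 * x / 4 ≤ 2 * x / (1 + x) ^ 2 := div_le_div_of_nonneg_left (by linarith) hpos hsq
  linarith

end Dictionary

/-! ## §3 The reductions -/

/-- Index bookkeeping: for `8 ≤ L` and `2L ≤ L'`, the cold times satisfy `⌊L/4⌋ = m + 2` for some `m` and `⌊L'/4⌋ = k + 2` with `2(m+2) ≤ k + 2`. -/
theorem exists_coldTimes {L L' : ℕ} (hL : 8 ≤ L) (hLL' : 2 * L ≤ L') :
    ∃ m k : ℕ, L / 4 = m + 2 ∧ L' / 4 = k + 2 ∧ 2 * m + 2 ≤ k :=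
  ⟨L / 4 - 2, L' / 4 - 2, by omega, by omega, by omega⟩

/-- **The engine**: on any coupling window `[0, βw]` contained in `[0, strongCouplingRadius r.ρ]`, a volume comparison with constant `K` for
`L ≥ L₀` yields the dyadic contraction `δᶜ_β(L') ≤ (8K² + 1)·δᶜ_β(L)²` for `L ≥ max(L₀, L₁, 8)`, `L' ∈ [2L, 4L]` (`L₁` the uniform
smallness threshold `x_{⌊L/4⌋}(L) ≤ 1` of `Rate.traceExcess_small_of_large`). -/
theorem coldDoubling_of_volumeComparison_window {G : Type} [Group G] [TopologicalSpace G] [IsTopologicalGroup G]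
    [CompactSpace G] [MeasurableSpace G] [BorelSpace G] (r : LatticeRep G) {βw K : ℝ} (hβw : βw ≤ strongCouplingRadius r.ρ)
    (hK : 0 ≤ K) {L₀ : ℕ}
    (hVC : ∀ β : ℝ, 0 ≤ β → β ≤ βw →
      ∀ (L : ℕ) [NeZero L] (L' : ℕ) [NeZero L'] (m : ℕ), L / 4 = m + 2 → L₀ ≤ L → 2 * L ≤ L' → L' ≤ 4 * L →
        traceExcess r.ρ β L' (m + 2) ≤ K * traceExcess r.ρ β L (m + 2)) :
    ∃ L₂ : ℕ, ∀ β : ℝ, 0 ≤ β → β ≤ βw → ∀ L : ℕ, L₂ ≤ L → ∀ L' : ℕ, 2 * L ≤ L' → L' ≤ 4 * L →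
      coldDefect r.ρ β L' ≤ (8 * K ^ 2 + 1) * coldDefect r.ρ β L ^ 2 := by
  haveI : SecondCountableTopology G :=
    (r.continuous.isClosedEmbedding r.injective).isEmbedding.secondCountableTopology
  obtain ⟨L₁, hL₁⟩ := Rate.traceExcess_small_of_large r.continuous r.mem_unitary (ε := 1) one_pos
  refine ⟨max L₀ (max L₁ 8), fun β hβ0 hβ L hL L' hLL' hL'L => ?_⟩
  have hL0 : L₀ ≤ L := le_trans (le_max_left _ _) hL
  have hL1 : L₁ ≤ L := le_trans ((le_max_left _ _).trans (le_max_right _ _)) hL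
  have hL8 : 8 ≤ L := le_trans ((le_max_right _ _).trans (le_max_right _ _)) hL
  haveI : NeZero L := ⟨by omega⟩
  haveI : NeZero L' := ⟨by omega⟩
  obtain ⟨m, k, hm, hk, hmk⟩ := exists_coldTimes hL8 hLL'
  have hβr : β ≤ strongCouplingRadius r.ρ := hβ.trans hβw
  -- the chain `δᶜ(L') ≤ 2x_{k+2}(L') ≤ 2x_{2(m+2)}(L') ≤ 2x_{m+2}(L')² ≤ 2K²x_{m+2}(L)² ≤ 8K²δᶜ(L)²`
  have h1 : coldDefect r.ρ β L' ≤ 2 * traceExcess r.ρ β L' (k + 2) := coldDefect_le_two_mul_traceExcess r hβ0 L' k hk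
  have h2 : traceExcess r.ρ β L' (k + 2) ≤ traceExcess r.ρ β L' (2 * m + 2 + 2) := traceExcess_antitone_time r hβ0 L' hmk
  have h3 : traceExcess r.ρ β L' (2 * m + 2 + 2) ≤ traceExcess r.ρ β L' (m + 2) ^ 2 := traceExcess_two_mul_le_sq r hβ0 L' m
  have h4 : traceExcess r.ρ β L' (m + 2) ≤ K * traceExcess r.ρ β L (m + 2) := hVC β hβ0 hβ L L' m hm hL0 hLL' hL'L
  have hxL'0 : 0 ≤ traceExcess r.ρ β L' (m + 2) := Rate.traceExcess_nonneg r.continuous r.mem_unitary hβ0 L' m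
  have hxL1 : traceExcess r.ρ β L (m + 2) ≤ 1 := hL₁ β hβ0 hβr L m hm hL1
  have h5 : traceExcess r.ρ β L (m + 2) ≤ 2 * coldDefect r.ρ β L := traceExcess_le_two_mul_coldDefect r hβ0 L m hm hxL1
  have hxL0 : 0 ≤ traceExcess r.ρ β L (m + 2) := Rate.traceExcess_nonneg r.continuous r.mem_unitary hβ0 L m
  have h45 : traceExcess r.ρ β L' (m + 2) ≤ K * (2 * coldDefect r.ρ β L) :=
    h4.trans (mul_le_mul_of_nonneg_left h5 hK)
  have hsq : traceExcess r.ρ β L' (m + 2) ^ 2 ≤ (K * (2 * coldDefect r.ρ β L)) ^ 2 :=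
    pow_le_pow_left₀ hxL'0 h45 2
  have hδ0 : 0 ≤ coldDefect r.ρ β L ^ 2 := sq_nonneg _
  calc coldDefect r.ρ β L' ≤ 2 * traceExcess r.ρ β L' (m + 2) ^ 2 := by linarith [h1, h2, h3]
    _ ≤ 2 * (K * (2 * coldDefect r.ρ β L)) ^ 2 := by linarith [hsq]
    _ = 8 * K ^ 2 * coldDefect r.ρ β L ^ 2 := by ring
    _ ≤ (8 * K ^ 2 + 1) * coldDefect r.ρ β L ^ 2 := by nlinarith [hδ0]

/-- **`TraceExcessVolumeComparison → ColdDoublingRecursionStrongCoupling`** (same-volume squaring): the IR cell's strong-coupling rung — the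
closes-target of route `GlueballBandRecursion` — follows from the volume comparison of the cold trace excess alone, with `C = 8K² + 1`.  Only the
implication is proved; the volume comparison is OPEN; no mass gap is claimed. -/
theorem coldDoublingRecursionStrongCoupling_of_volumeComparison (h : TraceExcessVolumeComparison) :
    ColdDoublingRecursionStrongCoupling := by
  intro G _ _ _ _
  letI : MeasurableSpace G := borel G
  haveI : BorelSpace G := ⟨rfl⟩
  intro r
  obtain ⟨K, hK, L₀, hVC⟩ := h G r
  obtain ⟨L₂, hL₂⟩ := coldDoubling_of_volumeComparison_window r le_rfl hK hVC
  exact ⟨8 * K ^ 2 + 1, by positivity, L₂, fun β hβ0 hβ L hL L' hLL' hL'L => hL₂ β hβ0 hβ L hL L' hLL' hL'L⟩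

/-- **`TraceExcessVolumeComparisonSmallCoupling → ColdDoublingRecursionSmallCoupling`**: the same reduction on the small-coupling window
`[0, min β₁ (strongCouplingRadius r.ρ)]`.  Only the implication is proved; no mass gap is claimed. -/
theorem coldDoublingRecursionSmallCoupling_of_volumeComparison (h : TraceExcessVolumeComparisonSmallCoupling) :
    ColdDoublingRecursionSmallCoupling := by
  intro G _ _ _ _
  letI : MeasurableSpace G := borel G
  haveI : BorelSpace G := ⟨rfl⟩
  intro r
  obtain ⟨β₁, hβ₁, K, hK, L₀, hVC⟩ := h G r
  have hVC' : ∀ β : ℝ, 0 ≤ β → β ≤ min β₁ (strongCouplingRadius r.ρ) →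
      ∀ (L : ℕ) [NeZero L] (L' : ℕ) [NeZero L'] (m : ℕ), L / 4 = m + 2 → L₀ ≤ L → 2 * L ≤ L' → L' ≤ 4 * L →
        traceExcess r.ρ β L' (m + 2) ≤ K * traceExcess r.ρ β L (m + 2) :=
    fun β hβ0 hβ L _ L' _ m hm hL hLL' hL'L => hVC β hβ0 (hβ.trans (min_le_left _ _)) L L' m hm hL hLL' hL'L
  obtain ⟨L₂, hL₂⟩ := coldDoubling_of_volumeComparison_window r (min_le_right _ _) hK hVC'
  exact ⟨min β₁ (strongCouplingRadius r.ρ), lt_min hβ₁ (strongCouplingRadius_pos r.ρ), 8 * K ^ 2 + 1, by positivity, L₂,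
    fun β hβ0 hβ L hL L' hLL' hL'L => hL₂ β hβ0 hβ L hL L' hLL' hL'L⟩

/-- Window weakening (sanity): the typed volume comparison implies its small-coupling form (`β₁ := strongCouplingRadius r.ρ`). -/
theorem traceExcessVolumeComparisonSmallCoupling_of_volumeComparison (h : TraceExcessVolumeComparison) :
    TraceExcessVolumeComparisonSmallCoupling := by
  intro G _ _ _ _
  letI : MeasurableSpace G := borel G
  haveI : BorelSpace G := ⟨rfl⟩
  intro r
  obtain ⟨K, hK, L₀, hVC⟩ := h G r
  exact ⟨strongCouplingRadius r.ρ, strongCouplingRadius_pos r.ρ, K, hK, L₀,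
    fun β hβ0 hβ L _ L' _ m hm hL hLL' hL'L => hVC β hβ0 hβ L L' m hm hL hLL' hL'L⟩

/-- Window weakening (sanity): the IR cell's rung implies its small-coupling form (`β₁ := strongCouplingRadius r.ρ`). -/
theorem coldDoublingRecursionSmallCoupling_of_strongCoupling (h : ColdDoublingRecursionStrongCoupling) :
    ColdDoublingRecursionSmallCoupling := by
  intro G _ _ _ _
  letI : MeasurableSpace G := borel G
  haveI : BorelSpace G := ⟨rfl⟩
  intro r
  obtain ⟨C, hC, L₀, hR⟩ := h G r
  exact ⟨strongCouplingRadius r.ρ, strongCouplingRadius_pos r.ρ, C, hC, L₀,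
    fun β hβ0 hβ L hL L' hLL' hL'L => hR β hβ0 hβ L hL L' hLL' hL'L⟩

end Summit.QuantumFields.YangMills.Theorems.GlueballBandRecursion

end
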